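import Summits.KontsevichZagierPeriods.KontsevichZagierPeriods.Theorems.RootDecompRelativeModAbsoluteCircleLogP9

/-! # `RootDecompRelativeModAbsoluteCircleLogP10` — part 10/11 of the mechanical ≤400-line split of `CircleLogTranscendence_landing.lean` (sha256 022159109aaffa3a…)
Source: decomp-kz lens-3 g13 `CircleLogTranscendence_v9.lean` (HOME/decomp-kz-lens-3/g13/, sha256 afb45a43…; critic g5-45/60/65/68/69 CLEARED FOR LANDING --supports 30572 (§4 defs, §8–§10 CircleLogStructureAt 0 from the tree's baker_decomposition_complex, constant-data cells every n, §16–§23 descent ingredients); landed by census-1 g9 over the landed CylLogSplitP52 (BLOCK G13): the duplicate def CircleLogStructure is dropped in favour of the landed one).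
Split by census-1 g9 `gen/splitlean.py`: scopes re-opened with their `open`/`variable`/`set_option` context; mathematics and declaration order unchanged. -/

noncomputable section
open Set MeasureTheory Filter Topology
open scoped BigOperators
open Literature.NumberTheory.Transcendental Literature.ModelTheory.ExponentialFields
namespace Summit.KontsevichZagierPeriods.RootDecompRelativeModAbsolute.Rung30571.RegularisedLogLayer.CylLog.Leaf
namespace G13

/-- **Elimination by an exact angle relation — translating the structure data back** (every `n`): the structure conclusion for
the reduced coefficients `p̃ⱼ = pⱼ − p_{j₀} f′₀ⱼ / f′₀_{j₀}` implies the conclusion for `p` (append the EXACT relation `f′₀`, `m = 0`, with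
the `ℚ`-sa coefficient `p_{j₀} / f′₀_{j₀}`; the budget is unchanged). -/
theorem circleLogStructure_elimAngle {n k l : ℕ} {U : Set (Fin n → ℝ)}
    {h W : Fin k → (Fin n → ℝ) → ℝ} {p u : Fin l → (Fin n → ℝ) → ℝ} {g : (Fin n → ℝ) → ℝ}
    (hp : ∀ j, IsSemialgebraicFunOn ℚ U (p j)) (f₀ : Fin l → ℤ) (j₀ : Fin l) (hf₀ : f₀ j₀ ≠ 0)
    (hrel₀ : ∀ x ∈ U, ∑ j, (f₀ j : ℝ) * Real.arctan (u j x) = 0)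
    (hred : ∃ (N : ℕ) (C : Fin N → Set (Fin n → ℝ)),
      (∀ c, IsSemialgebraic ℚ (C c) ∧ IsOpen (C c) ∧ C c ⊆ U) ∧
      Pairwise (Function.onFun Disjoint C) ∧ volume (U \ ⋃ c, C c) = 0 ∧
      ∀ c, (∀ x ∈ C c, g x = 0) ∧
        ∃ (R : ℕ) (f : Fin R → Fin k → ℤ) (q : Fin R → (Fin n → ℝ) → ℝ)
          (S : ℕ) (f' : Fin S → Fin l → ℤ) (m : Fin S → ℚ) (q' : Fin S → (Fin n → ℝ) → ℝ),
          (∀ r, IsSemialgebraicFunOn ℚ (C c) (q r)) ∧ (∀ r, ∀ x ∈ C c, ∏ i, W i x ^ (f r i) = 1) ∧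
          (∀ i, ∀ x ∈ C c, h i x = ∑ r, q r x * (f r i : ℝ)) ∧
          (∀ s, IsSemialgebraicFunOn ℚ (C c) (q' s)) ∧
          (∀ s, ∀ x ∈ C c, ∑ j, (f' s j : ℝ) * Real.arctan (u j x) = (m s : ℝ) * Real.pi) ∧
          (∀ x ∈ C c, ∑ s, q' s x * (m s : ℝ) = 0) ∧
          (∀ j, ∀ x ∈ C c, (p j x - p j₀ x * ((f₀ j : ℝ) / (f₀ j₀ : ℝ))) = ∑ s, q' s x * (f' s j : ℝ))) :
    ∃ (N : ℕ) (C : Fin N → Set (Fin n → ℝ)),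
      (∀ c, IsSemialgebraic ℚ (C c) ∧ IsOpen (C c) ∧ C c ⊆ U) ∧
      Pairwise (Function.onFun Disjoint C) ∧ volume (U \ ⋃ c, C c) = 0 ∧
      ∀ c, (∀ x ∈ C c, g x = 0) ∧
        ∃ (R : ℕ) (f : Fin R → Fin k → ℤ) (q : Fin R → (Fin n → ℝ) → ℝ)
          (S : ℕ) (f' : Fin S → Fin l → ℤ) (m : Fin S → ℚ) (q' : Fin S → (Fin n → ℝ) → ℝ),
          (∀ r, IsSemialgebraicFunOn ℚ (C c) (q r)) ∧ (∀ r, ∀ x ∈ C c, ∏ i, W i x ^ (f r i) = 1) ∧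
          (∀ i, ∀ x ∈ C c, h i x = ∑ r, q r x * (f r i : ℝ)) ∧
          (∀ s, IsSemialgebraicFunOn ℚ (C c) (q' s)) ∧
          (∀ s, ∀ x ∈ C c, ∑ j, (f' s j : ℝ) * Real.arctan (u j x) = (m s : ℝ) * Real.pi) ∧
          (∀ x ∈ C c, ∑ s, q' s x * (m s : ℝ) = 0) ∧
          (∀ j, ∀ x ∈ C c, p j x = ∑ s, q' s x * (f' s j : ℝ)) := by
  classical
  obtain ⟨N, C, hC, hdisj, hnull, hcell⟩ := hred
  refine ⟨N, C, hC, hdisj, hnull, fun c₀ => ?_⟩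
  obtain ⟨hg0, R, f, q, S, f', m, q', hq, hrel, hhq, hq', hrel', hbud, hpq⟩ := hcell c₀
  have hCU : C c₀ ⊆ U := (hC c₀).2.2
  have hq₀ : IsSemialgebraicFunOn ℚ (C c₀) (fun x => p j₀ x / (f₀ j₀ : ℝ)) := by
    have h1 : IsSemialgebraicFunOn ℚ (C c₀) (p j₀) := (hp j₀).mono hCU (hC c₀).1
    have h2 : IsSemialgebraicFunOn ℚ (C c₀) (fun _ => ((f₀ j₀ : ℚ) : ℝ)) :=
      isSemialgebraicFunOn_const_ratCast (hC c₀).1 (f₀ j₀ : ℚ)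
    have h3 := h1.div h2 (fun x _ => by exact_mod_cast hf₀)
    exact h3.congr fun x _ => by push_cast; rfl
  refine ⟨hg0, R, f, q, S + 1, Fin.snoc f' f₀, Fin.snoc m 0, Fin.snoc q' (fun x => p j₀ x / (f₀ j₀ : ℝ)), hq, hrel, hhq,
    ?_, ?_, ?_, ?_⟩
  · intro s
    refine Fin.lastCases ?_ (fun s' => ?_) s
    · simpa only [Fin.snoc_last] using hq₀
    · simpa only [Fin.snoc_castSucc] using hq' s'
  · intro s x hx
    refine Fin.lastCases ?_ (fun s' => ?_) s
    · simp only [Fin.snoc_last, Rat.cast_zero, zero_mul]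
      exact hrel₀ x (hCU hx)
    · simpa only [Fin.snoc_castSucc] using hrel' s' x hx
  · intro x hx
    rw [Fin.sum_univ_castSucc]
    simp only [Fin.snoc_castSucc, Fin.snoc_last, Rat.cast_zero, mul_zero, add_zero]
    exact hbud x hx
  · intro j x hx
    rw [Fin.sum_univ_castSucc]
    simp only [Fin.snoc_castSucc, Fin.snoc_last]
    have e := hpq j x hx
    have hf0 : (f₀ j₀ : ℝ) ≠ 0 := by exact_mod_cast hf₀
    have : p j x = ∑ s, q' s x * (f' s j : ℝ) + p j₀ x * ((f₀ j : ℝ) / (f₀ j₀ : ℝ)) := by rw [← e]; ring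
    rw [this]
    congr 1
    field_simp

/-! ### §22 Dropping a term whose coefficient vanishes identically (descent step 1, every `n`) — PROVED

Reindex by `Fin.succAbove`; translate the structure data back by extending each relation with exponent `0` at the dropped index (`Fin.insertNth`).
With §21 this makes the term count DROP in the descent (eliminate ⇒ coefficient `≡ 0` ⇒ drop). -/

/-- **Dropping a log term with identically vanishing coefficient — the identity.** -/
theorem circle_identity_dropLog {n k l : ℕ} {U : Set (Fin n → ℝ)}
    {h W : Fin (k + 1) → (Fin n → ℝ) → ℝ} {p u : Fin l → (Fin n → ℝ) → ℝ} {g : (Fin n → ℝ) → ℝ}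
    (i₀ : Fin (k + 1)) (hzero : ∀ x ∈ U, h i₀ x = 0)
    (hid : ∀ x ∈ U, ∑ i, h i x * Real.log (W i x) + ∑ j, p j x * Real.arctan (u j x) = g x) :
    ∀ x ∈ U, ∑ i, h (i₀.succAbove i) x * Real.log (W (i₀.succAbove i) x) +
      ∑ j, p j x * Real.arctan (u j x) = g x := by
  intro x hx
  rw [← hid x hx, Fin.sum_univ_succAbove _ i₀, hzero x hx, zero_mul, zero_add]

/-- **Dropping a log term with identically vanishing coefficient — translating the structure data back** (every `n`): extend each
relation by the exponent `0` at the dropped index. -/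
theorem circleLogStructure_dropLog {n k l : ℕ} {U : Set (Fin n → ℝ)}
    {h W : Fin (k + 1) → (Fin n → ℝ) → ℝ} {p u : Fin l → (Fin n → ℝ) → ℝ} {g : (Fin n → ℝ) → ℝ}
    (i₀ : Fin (k + 1)) (hzero : ∀ x ∈ U, h i₀ x = 0)
    (hred : ∃ (N : ℕ) (C : Fin N → Set (Fin n → ℝ)),
      (∀ c, IsSemialgebraic ℚ (C c) ∧ IsOpen (C c) ∧ C c ⊆ U) ∧
      Pairwise (Function.onFun Disjoint C) ∧ volume (U \ ⋃ c, C c) = 0 ∧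
      ∀ c, (∀ x ∈ C c, g x = 0) ∧
        ∃ (R : ℕ) (f : Fin R → Fin k → ℤ) (q : Fin R → (Fin n → ℝ) → ℝ)
          (S : ℕ) (f' : Fin S → Fin l → ℤ) (m : Fin S → ℚ) (q' : Fin S → (Fin n → ℝ) → ℝ),
          (∀ r, IsSemialgebraicFunOn ℚ (C c) (q r)) ∧
          (∀ r, ∀ x ∈ C c, ∏ i, W (i₀.succAbove i) x ^ (f r i) = 1) ∧
          (∀ i, ∀ x ∈ C c, h (i₀.succAbove i) x = ∑ r, q r x * (f r i : ℝ)) ∧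
          (∀ s, IsSemialgebraicFunOn ℚ (C c) (q' s)) ∧
          (∀ s, ∀ x ∈ C c, ∑ j, (f' s j : ℝ) * Real.arctan (u j x) = (m s : ℝ) * Real.pi) ∧
          (∀ x ∈ C c, ∑ s, q' s x * (m s : ℝ) = 0) ∧
          (∀ j, ∀ x ∈ C c, p j x = ∑ s, q' s x * (f' s j : ℝ))) :
    ∃ (N : ℕ) (C : Fin N → Set (Fin n → ℝ)),
      (∀ c, IsSemialgebraic ℚ (C c) ∧ IsOpen (C c) ∧ C c ⊆ U) ∧
      Pairwise (Function.onFun Disjoint C) ∧ volume (U \ ⋃ c, C c) = 0 ∧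
      ∀ c, (∀ x ∈ C c, g x = 0) ∧
        ∃ (R : ℕ) (f : Fin R → Fin (k + 1) → ℤ) (q : Fin R → (Fin n → ℝ) → ℝ)
          (S : ℕ) (f' : Fin S → Fin l → ℤ) (m : Fin S → ℚ) (q' : Fin S → (Fin n → ℝ) → ℝ),
          (∀ r, IsSemialgebraicFunOn ℚ (C c) (q r)) ∧ (∀ r, ∀ x ∈ C c, ∏ i, W i x ^ (f r i) = 1) ∧
          (∀ i, ∀ x ∈ C c, h i x = ∑ r, q r x * (f r i : ℝ)) ∧
          (∀ s, IsSemialgebraicFunOn ℚ (C c) (q' s)) ∧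
          (∀ s, ∀ x ∈ C c, ∑ j, (f' s j : ℝ) * Real.arctan (u j x) = (m s : ℝ) * Real.pi) ∧
          (∀ x ∈ C c, ∑ s, q' s x * (m s : ℝ) = 0) ∧
          (∀ j, ∀ x ∈ C c, p j x = ∑ s, q' s x * (f' s j : ℝ)) := by
  classical
  obtain ⟨N, C, hC, hdisj, hnull, hcell⟩ := hred
  refine ⟨N, C, hC, hdisj, hnull, fun c₀ => ?_⟩
  obtain ⟨hg0, R, f, q, S, f', m, q', hq, hrel, hhq, hq', hrel', hbud, hpq⟩ := hcell c₀
  have hCU : C c₀ ⊆ U := (hC c₀).2.2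
  refine ⟨hg0, R, fun r => Fin.insertNth i₀ (0 : ℤ) (f r), q, S, f', m, q', hq, ?_, ?_, hq', hrel', hbud, hpq⟩
  · intro r x hx
    rw [Fin.prod_univ_succAbove _ i₀]
    simp only [Fin.insertNth_apply_same, Fin.insertNth_apply_succAbove, zpow_zero, one_mul]
    exact hrel r x hx
  · intro i x hx
    refine Fin.succAboveCases i₀ ?_ (fun i' => ?_) i
    · simp only [Fin.insertNth_apply_same, Int.cast_zero, mul_zero, Finset.sum_const_zero]
      exact hzero x (hCU hx)
    · simp only [Fin.insertNth_apply_succAbove]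
      exact hhq i' x hx

/-- **Dropping an angle term with identically vanishing coefficient — the identity.** -/
theorem circle_identity_dropAngle {n k l : ℕ} {U : Set (Fin n → ℝ)}
    {h W : Fin k → (Fin n → ℝ) → ℝ} {p u : Fin (l + 1) → (Fin n → ℝ) → ℝ} {g : (Fin n → ℝ) → ℝ}
    (j₀ : Fin (l + 1)) (hzero : ∀ x ∈ U, p j₀ x = 0)
    (hid : ∀ x ∈ U, ∑ i, h i x * Real.log (W i x) + ∑ j, p j x * Real.arctan (u j x) = g x) :
    ∀ x ∈ U, ∑ i, h i x * Real.log (W i x) +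
      ∑ j, p (j₀.succAbove j) x * Real.arctan (u (j₀.succAbove j) x) = g x := by
  intro x hx
  rw [← hid x hx, Fin.sum_univ_succAbove (fun j => p j x * Real.arctan (u j x)) j₀, hzero x hx, zero_mul, zero_add]

/-- **Dropping an angle term with identically vanishing coefficient — translating the structure data back** (every `n`). -/
theorem circleLogStructure_dropAngle {n k l : ℕ} {U : Set (Fin n → ℝ)}
    {h W : Fin k → (Fin n → ℝ) → ℝ} {p u : Fin (l + 1) → (Fin n → ℝ) → ℝ} {g : (Fin n → ℝ) → ℝ}
    (j₀ : Fin (l + 1)) (hzero : ∀ x ∈ U, p j₀ x = 0)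
    (hred : ∃ (N : ℕ) (C : Fin N → Set (Fin n → ℝ)),
      (∀ c, IsSemialgebraic ℚ (C c) ∧ IsOpen (C c) ∧ C c ⊆ U) ∧
      Pairwise (Function.onFun Disjoint C) ∧ volume (U \ ⋃ c, C c) = 0 ∧
      ∀ c, (∀ x ∈ C c, g x = 0) ∧
        ∃ (R : ℕ) (f : Fin R → Fin k → ℤ) (q : Fin R → (Fin n → ℝ) → ℝ)
          (S : ℕ) (f' : Fin S → Fin l → ℤ) (m : Fin S → ℚ) (q' : Fin S → (Fin n → ℝ) → ℝ),
          (∀ r, IsSemialgebraicFunOn ℚ (C c) (q r)) ∧ (∀ r, ∀ x ∈ C c, ∏ i, W i x ^ (f r i) = 1) ∧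
          (∀ i, ∀ x ∈ C c, h i x = ∑ r, q r x * (f r i : ℝ)) ∧
          (∀ s, IsSemialgebraicFunOn ℚ (C c) (q' s)) ∧
          (∀ s, ∀ x ∈ C c, ∑ j, (f' s j : ℝ) * Real.arctan (u (j₀.succAbove j) x) = (m s : ℝ) * Real.pi) ∧
          (∀ x ∈ C c, ∑ s, q' s x * (m s : ℝ) = 0) ∧
          (∀ j, ∀ x ∈ C c, p (j₀.succAbove j) x = ∑ s, q' s x * (f' s j : ℝ))) :
    ∃ (N : ℕ) (C : Fin N → Set (Fin n → ℝ)),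
      (∀ c, IsSemialgebraic ℚ (C c) ∧ IsOpen (C c) ∧ C c ⊆ U) ∧
      Pairwise (Function.onFun Disjoint C) ∧ volume (U \ ⋃ c, C c) = 0 ∧
      ∀ c, (∀ x ∈ C c, g x = 0) ∧
        ∃ (R : ℕ) (f : Fin R → Fin k → ℤ) (q : Fin R → (Fin n → ℝ) → ℝ)
          (S : ℕ) (f' : Fin S → Fin (l + 1) → ℤ) (m : Fin S → ℚ) (q' : Fin S → (Fin n → ℝ) → ℝ),
          (∀ r, IsSemialgebraicFunOn ℚ (C c) (q r)) ∧ (∀ r, ∀ x ∈ C c, ∏ i, W i x ^ (f r i) = 1) ∧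
          (∀ i, ∀ x ∈ C c, h i x = ∑ r, q r x * (f r i : ℝ)) ∧
          (∀ s, IsSemialgebraicFunOn ℚ (C c) (q' s)) ∧
          (∀ s, ∀ x ∈ C c, ∑ j, (f' s j : ℝ) * Real.arctan (u j x) = (m s : ℝ) * Real.pi) ∧
          (∀ x ∈ C c, ∑ s, q' s x * (m s : ℝ) = 0) ∧
          (∀ j, ∀ x ∈ C c, p j x = ∑ s, q' s x * (f' s j : ℝ)) := by
  classical
  obtain ⟨N, C, hC, hdisj, hnull, hcell⟩ := hred
  refine ⟨N, C, hC, hdisj, hnull, fun c₀ => ?_⟩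
  obtain ⟨hg0, R, f, q, S, f', m, q', hq, hrel, hhq, hq', hrel', hbud, hpq⟩ := hcell c₀
  have hCU : C c₀ ⊆ U := (hC c₀).2.2
  refine ⟨hg0, R, f, q, S, fun s => Fin.insertNth j₀ (0 : ℤ) (f' s), m, q', hq, hrel, hhq, hq', ?_, hbud, ?_⟩
  · intro s x hx
    rw [Fin.sum_univ_succAbove _ j₀]
    simp only [Fin.insertNth_apply_same, Fin.insertNth_apply_succAbove, Int.cast_zero, zero_mul, zero_add]
    exact hrel' s x hx
  · intro j x hx
    refine Fin.succAboveCases j₀ ?_ (fun j' => ?_) j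
    · simp only [Fin.insertNth_apply_same, Int.cast_zero, mul_zero, Finset.sum_const_zero]
      exact hzero x (hCU hx)
    · simp only [Fin.insertNth_apply_succAbove]
      exact hpq j' x hx

/-! ### §23 The EXACT structure predicate `CircleStructExactOn` — the invariant of the descent — and the exact twins of §17–§22 (PROVED)

The induction for `CircleLogStructureMovingCirc` / `CircleLogStructureAt 1` must run on this predicate (all angle relations `= 0`): case (b′) of the
descent step eliminates an angle term by a relation RETURNED by the recursive call, which therefore has to be exact.  `circleLogStructure_of_exact`
converts to the `CircleLogStructure` conclusion at the end (`m ≡ 0`).  The twins: `circleStructExact_constCoeff` (bottom, from §16), `_projConstCoeff`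
(case (a)), `_of_cells` (glue), `_elimLog` / `_elimAngle` (case (b)/(b′)), `_dropLog` / `_dropAngle` (term count drops). -/

/-- **The EXACT structure predicate** (the invariant of the descent): the `CircleLogStructure` conclusion for the data
`(h, W, p, u, g)` on `U` with ALL angle relations exact (`Σ f′ arctan u = 0`; no `m`, no budget). -/
abbrev CircleStructExactOn {n : ℕ} (k l : ℕ) (U : Set (Fin n → ℝ)) (h W : Fin k → (Fin n → ℝ) → ℝ)
    (p u : Fin l → (Fin n → ℝ) → ℝ) (g : (Fin n → ℝ) → ℝ) : Prop :=
  ∃ (N : ℕ) (C : Fin N → Set (Fin n → ℝ)),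
    (∀ c, IsSemialgebraic ℚ (C c) ∧ IsOpen (C c) ∧ C c ⊆ U) ∧
    Pairwise (Function.onFun Disjoint C) ∧ volume (U \ ⋃ c, C c) = 0 ∧
    ∀ c, (∀ x ∈ C c, g x = 0) ∧
      ∃ (R : ℕ) (f : Fin R → Fin k → ℤ) (q : Fin R → (Fin n → ℝ) → ℝ)
        (S : ℕ) (f' : Fin S → Fin l → ℤ) (q' : Fin S → (Fin n → ℝ) → ℝ),
        (∀ r, IsSemialgebraicFunOn ℚ (C c) (q r)) ∧ (∀ r, ∀ x ∈ C c, ∏ i, W i x ^ (f r i) = 1) ∧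
        (∀ i, ∀ x ∈ C c, h i x = ∑ r, q r x * (f r i : ℝ)) ∧
        (∀ s, IsSemialgebraicFunOn ℚ (C c) (q' s)) ∧
        (∀ s, ∀ x ∈ C c, ∑ j, (f' s j : ℝ) * Real.arctan (u j x) = 0) ∧
        (∀ j, ∀ x ∈ C c, p j x = ∑ s, q' s x * (f' s j : ℝ))

/-- Exact structure ⇒ the `CircleLogStructure` conclusion (take `m ≡ 0`; the budget is then trivial). -/
theorem circleLogStructure_of_exact {n k l : ℕ} {U : Set (Fin n → ℝ)} {h W : Fin k → (Fin n → ℝ) → ℝ}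
    {p u : Fin l → (Fin n → ℝ) → ℝ} {g : (Fin n → ℝ) → ℝ} (hE : CircleStructExactOn k l U h W p u g) :
    ∃ (N : ℕ) (C : Fin N → Set (Fin n → ℝ)),
      (∀ c, IsSemialgebraic ℚ (C c) ∧ IsOpen (C c) ∧ C c ⊆ U) ∧
      Pairwise (Function.onFun Disjoint C) ∧ volume (U \ ⋃ c, C c) = 0 ∧
      ∀ c, (∀ x ∈ C c, g x = 0) ∧
        ∃ (R : ℕ) (f : Fin R → Fin k → ℤ) (q : Fin R → (Fin n → ℝ) → ℝ)
          (S : ℕ) (f' : Fin S → Fin l → ℤ) (m : Fin S → ℚ) (q' : Fin S → (Fin n → ℝ) → ℝ),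
          (∀ r, IsSemialgebraicFunOn ℚ (C c) (q r)) ∧ (∀ r, ∀ x ∈ C c, ∏ i, W i x ^ (f r i) = 1) ∧
          (∀ i, ∀ x ∈ C c, h i x = ∑ r, q r x * (f r i : ℝ)) ∧
          (∀ s, IsSemialgebraicFunOn ℚ (C c) (q' s)) ∧
          (∀ s, ∀ x ∈ C c, ∑ j, (f' s j : ℝ) * Real.arctan (u j x) = (m s : ℝ) * Real.pi) ∧
          (∀ x ∈ C c, ∑ s, q' s x * (m s : ℝ) = 0) ∧
          (∀ j, ∀ x ∈ C c, p j x = ∑ s, q' s x * (f' s j : ℝ)) := by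
  obtain ⟨N, C, hC, hdisj, hnull, hcell⟩ := hE
  refine ⟨N, C, hC, hdisj, hnull, fun c₀ => ?_⟩
  obtain ⟨hg0, R, f, q, S, f', q', hq, hrel, hhq, hq', hrel', hpq⟩ := hcell c₀
  refine ⟨hg0, R, f, q, S, f', fun _ => 0, q', hq, hrel, hhq, hq', fun s x hx => ?_, fun x _ => by simp, hpq⟩
  rw [hrel' s x hx]; simp

/-- Exact twin of §17: constant coefficients, moving data ⇒ EXACT structure (from §16). -/
theorem circleStructExact_constCoeff {n k l : ℕ} {U : Set (Fin n → ℝ)} (hU : IsSemialgebraic ℚ U) (hUo : IsOpen U)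
    {h W : Fin k → (Fin n → ℝ) → ℝ} {p u : Fin l → (Fin n → ℝ) → ℝ} {g : (Fin n → ℝ) → ℝ}
    (hh : ∀ i, IsSemialgebraicFunOn ℚ U (h i)) (hW : ∀ i, IsSemialgebraicFunOn ℚ U (W i))
    (hWc : ∀ i, ContinuousOn (W i) U) (hW0 : ∀ i, ∀ x ∈ U, 0 < W i x)
    (hp : ∀ j, IsSemialgebraicFunOn ℚ U (p j)) (hu : ∀ j, IsSemialgebraicFunOn ℚ U (u j))
    (huc : ∀ j, ContinuousOn (u j) U) (hg : IsSemialgebraicFunOn ℚ U g)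
    (hhc : ∀ i, ∀ x ∈ U, ∀ y ∈ U, h i x = h i y) (hpc : ∀ j, ∀ x ∈ U, ∀ y ∈ U, p j x = p j y)
    (hid : ∀ x ∈ U, ∑ i, h i x * Real.log (W i x) + ∑ j, p j x * Real.arctan (u j x) = g x) :
    CircleStructExactOn k l U h W p u g := by
  classical
  rcases U.eq_empty_or_nonempty with hUe | hUne
  · refine ⟨0, Fin.elim0, fun c => c.elim0, fun c => c.elim0, ?_, fun c => c.elim0⟩
    simp [hUe]
  obtain ⟨x₀, hx₀, hx₀alg⟩ := algebraicPoints U hU hUne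
  set c : Fin k → ℝ := fun i => h i x₀ with hc_def
  set d : Fin l → ℝ := fun j => p j x₀ with hd_def
  have hc : ∀ i, IsAlgebraic ℚ (c i) := fun i => (hh i).isAlgebraic_apply hx₀ hx₀alg
  have hd : ∀ j, IsAlgebraic ℚ (d j) := fun j => (hp j).isAlgebraic_apply hx₀ hx₀alg
  have hhx : ∀ i, ∀ x ∈ U, h i x = c i := fun i x hx => hhc i x hx x₀ hx₀
  have hpx : ∀ j, ∀ x ∈ U, p j x = d j := fun j x hx => hpc j x hx x₀ hx₀
  have hid' : ∀ x ∈ U, ∑ i, c i * Real.log (W i x) + ∑ j, d j * Real.arctan (u j x) = g x := by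
    intro x hx
    rw [← hid x hx]
    congr 1
    · exact Finset.sum_congr rfl fun i _ => by rw [hhx i x hx]
    · exact Finset.sum_congr rfl fun j _ => by rw [hpx j x hx]
  have hgc : ContinuousOn g U := by
    have hc' : ContinuousOn (fun x => ∑ i, c i * Real.log (W i x) + ∑ j, d j * Real.arctan (u j x)) U :=
      (continuousOn_finsetSum _ fun i _ =>
          continuousOn_const.mul ((hWc i).log fun x hx => (hW0 i x hx).ne')).add
        (continuousOn_finsetSum _ fun j _ =>
          continuousOn_const.mul (Real.continuous_arctan.comp_continuousOn (huc j)))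
    exact hc'.congr fun x hx => (hid' x hx).symm
  obtain ⟨hG0, ⟨R, f, β, hβ, hrel, hcf⟩, ⟨S, f', β', hβ', hrel', hdf⟩⟩ :=
    circleConstRigidity n k l U c d W u g hUo hc hd hW hWc hW0 hu huc hg hgc hid'
  have hnull : volume (U \ ⋃ _ : Fin 1, U) = 0 := by
    rw [Set.iUnion_const]; simp
  refine ⟨1, fun _ => U, fun _ => ⟨hU, hUo, subset_rfl⟩, fun a b hab => absurd (Subsingleton.elim a b) hab,
    hnull, fun _ => ⟨hG0, R, f, fun r _ => β r, S, f', fun s _ => β' s,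
      fun r => isSemialgebraicFunOn_const_of_isAlgebraic hU (hβ r), hrel, fun i x hx => ?_,
      fun s => isSemialgebraicFunOn_const_of_isAlgebraic hU (hβ' s), hrel', fun j x hx => ?_⟩⟩
  · rw [hhx i x hx]; exact hcf i
  · rw [hpx j x hx]; exact hdf j

end G13
end Summit.KontsevichZagierPeriods.RootDecompRelativeModAbsolute.Rung30571.RegularisedLogLayer.CylLog.Leaf
end
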